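import Summits.Langlands.Langlands.Theses.PicardMuOrdinary
import Literature.NumberTheory.Automorphic.AlgebraicityTwist

/-!
# `IrregularClassicality` (stmt-Langlands-13758) — Negative knowledge I: the congruence tower is
# rigid, a stationary family collapses to an exact match, and the normalisations are coherent

From the standing disprover's `Cruxes/IrregularClassicality/Disproof.lean` (cdisprove cycle 1,
2026-08-16).  The crux (route `PicardMuOrdinary`: "`ρ_C` a `3`-adic limit of regular algebraic
cuspidal `P_k` in Frobenius traces off a finite `S` ⇒ `C` automorphic") is NOT refuted — it only
adds a hypothesis to the target `PicardAutomorphy` (`PicardAutomorphy → IrregularClassicality`,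
one line, in `Disproof.lean`), so it is exactly as refutable as reciprocity for generic Picard
curves, and both sides quantify over the honest Borel–Jacquet datum
`CuspidalAutomorphicRepData 3 ℚ(ω) hcpt`, of which the tree has neither a closed inhabitant nor a
non-existence theorem.  This file lands what provers and planners can cite:

* `eq_zero_of_forall_congr` — in `ℤ̄ = integralClosure ℤ ℂ` with `𝔐 ∋ 3` maximal:
  `(∀ k, ∃ u ∉ 𝔐, u·t ∈ (3^k)) → t = 0` (the `𝔐`-adic valuation of a non-zero algebraic integer
  is finite).  So the crux's tower `N𝔭·Σα(P_k,𝔭) ≡ e(a_𝔭) (mod 3^k ℤ̄_𝔐)` cannot be served by ONE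
  `P` with one Satake witness per `𝔭` unless the match is exact.
* `isCAlgebraic_iff_isLAlgebraic_three` — for `GL₃`, C-algebraic = L-algebraic
  (`(3-1)/2 = 1 ∈ ℤ`); every regular algebraic `P_k` of the hypothesis is already L-algebraic.
* `automorphy_of_exact_regular_match` — an exact regular-algebraic match
  `N𝔭·Σα(P,𝔭) = e(a_𝔭(f))` (`𝔭 ∉ S`) gives the crux's (= the target's) conclusion for `f`, via the
  tree's twist `P ⊗ |det|_𝔸^{-1}` (`CuspidalAutomorphicRepData.exists_twist_hasInfinityType`,
  `AutomorphicRepData.HasSatakeParamAt.of_map_mulChar_detTwist_of_cpow`): the `N𝔭·Σα`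
  (C-normalised regular `P_k`) and `Σα` (L-algebraic `π`, summit `m = 1`) conventions of
  hypothesis and conclusion are mutually consistent — the route's kill criterion (6) finds nothing.
* `irregularClassicality_of_stationary` — the crux HOLDS whenever its tower is stationary
  (quantifiers `∃ P ∃ α t` in front of `∀ k`).  On paper that case is empty (`r(P)` has regular
  Hodge–Tate weights, `ρ_C` has `{0,0,1}`: `Literature.Barriers.Langlands.NonRegularWeightBarrier`),
  which is precisely why any proof needs a genuine `3`-adic limit object (unbounded weight or
  level at `S`) and why no cheap disproof exists.

Mathlib + the route file + `AlgebraicityTwist` only. [folklore]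
-/

set_option linter.dupNamespace false

namespace Summit.Langlands.Langlands.Theorems.IrregularClassicality.Negative

open Literature.NumberTheory.Automorphic Literature.NumberTheory.GaloisRepresentations
open NumberField IsDedekindDomain Polynomial Filter

open scoped Classical

/-! ### Rigidity of the `3^k`-congruence tower in `ℤ̄` -/

/-- A maximal ideal of `ℤ̄ = integralClosure ℤ ℂ` above `3` exists (lying over for the integral
extension `ℤ ⊆ ℤ̄`; `(3)` is maximal in `ℤ`). [folklore] -/
theorem exists_isMaximal_three_mem :
    ∃ 𝔐 : Ideal (integralClosure ℤ ℂ), 𝔐.IsMaximal ∧ (3 : integralClosure ℤ ℂ) ∈ 𝔐 := by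
  have h3 : (Ideal.span {(3 : ℤ)}).IsMaximal :=
    PrincipalIdealRing.isMaximal_of_irreducible Int.prime_three.irreducible
  obtain ⟨Q, hQ, hQc⟩ := Ideal.exists_ideal_over_maximal_of_isIntegral (S := integralClosure ℤ ℂ)
    (Ideal.span {(3 : ℤ)}) (fun x hx => by
      rw [RingHom.mem_ker] at hx
      have : (x : integralClosure ℤ ℂ) = 0 := hx
      have hx0 : x = 0 := by exact_mod_cast congrArg Subtype.val this
      simp [hx0])
  refine ⟨Q, hQ, ?_⟩
  have : (3 : ℤ) ∈ Q.comap (algebraMap ℤ (integralClosure ℤ ℂ)) := by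
    rw [hQc]; exact Ideal.mem_span_singleton_self 3
  simpa using this

/-- A non-zero algebraic integer divides a non-zero natural number in `ℤ̄` (the constant term of
an integral equation with non-vanishing constant coefficient). [folklore] -/
theorem exists_nat_ne_zero_dvd {t : integralClosure ℤ ℂ} (ht : t ≠ 0) :
    ∃ N : ℕ, N ≠ 0 ∧ t ∣ (N : integralClosure ℤ ℂ) := by
  have hint : IsIntegral ℤ t := Algebra.IsIntegral.isIntegral t
  obtain ⟨p, hmonic, hp⟩ := hint
  obtain ⟨q, hpq, hXq⟩ :=
    Polynomial.exists_eq_pow_rootMultiplicity_mul_and_not_dvd p hmonic.ne_zero 0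
  simp only [map_zero, sub_zero] at hpq hXq
  have hq0 : q.coeff 0 ≠ 0 := fun h0 => hXq (Polynomial.X_dvd_iff.2 h0)
  have hpt : aeval t p = 0 := hp
  have hqt : aeval t q = 0 := by
    rw [hpq, map_mul, map_pow, aeval_X] at hpt
    exact (mul_eq_zero.1 hpt).resolve_left (pow_ne_zero _ ht)
  have hc : ((q.coeff 0 : ℤ) : integralClosure ℤ ℂ) = t * (-(aeval t q.divX)) := by
    have h := congrArg (aeval t) (Polynomial.X_mul_divX_add q)
    rw [map_add, map_mul, aeval_X, aeval_C, hqt, eq_intCast] at h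
    linear_combination h
  refine ⟨(q.coeff 0).natAbs, Int.natAbs_ne_zero.2 hq0, ?_⟩
  have h1 : t ∣ ((q.coeff 0 : ℤ) : integralClosure ℤ ℂ) := ⟨_, hc⟩
  have h2 : ((q.coeff 0 : ℤ) : integralClosure ℤ ℂ) ∣
      (((q.coeff 0).natAbs : ℤ) : integralClosure ℤ ℂ) :=
    (Int.castRingHom (integralClosure ℤ ℂ)).map_dvd (Int.dvd_natAbs.2 dvd_rfl)
  rw [Int.cast_natCast] at h2
  exact h1.trans h2

/-- **Rigidity of the tower.** In `ℤ̄` with `𝔐 ∋ 3` maximal: if for every `k` some `u ∉ 𝔐` has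
`u · t ∈ (3^k)` — i.e. `t ∈ 3^k ℤ̄_𝔐` for all `k` — then `t = 0`.  (`t ∣ N = 3^a m` with `3 ∤ m`;
depth `a + 1` gives `3 ∣ u m`, so `u m ∈ 𝔐`, so `m ∈ 𝔐`, but `m` is prime to `3 ∈ 𝔐`.)  Hence in
`IrregularClassicality` a `P` and Satake witnesses independent of `k` force
`N𝔭·Σα(P,𝔭) = e(a_𝔭(f))` exactly. [folklore] -/
theorem eq_zero_of_forall_congr {𝔐 : Ideal (integralClosure ℤ ℂ)} (h𝔐 : 𝔐.IsMaximal)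
    (h3 : (3 : integralClosure ℤ ℂ) ∈ 𝔐) {t : integralClosure ℤ ℂ}
    (h : ∀ k : ℕ, ∃ u ∉ 𝔐, u * t ∈ Ideal.span {(3 : integralClosure ℤ ℂ) ^ k}) : t = 0 := by
  by_contra ht
  obtain ⟨N, hN0, w, hw⟩ := exists_nat_ne_zero_dvd ht
  obtain ⟨a, m, hm3, hNam⟩ := Nat.exists_eq_pow_mul_and_not_dvd hN0 3 (by norm_num)
  obtain ⟨u, hu, hut⟩ := h (a + 1)
  rw [Ideal.mem_span_singleton] at hut
  have h3a : (3 : integralClosure ℤ ℂ) ^ (a + 1) ∣ u * (N : integralClosure ℤ ℂ) := by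
    rw [hw, ← mul_assoc]; exact hut.mul_right w
  rw [hNam] at h3a
  push_cast at h3a
  have h3ne : (3 : integralClosure ℤ ℂ) ^ a ≠ 0 := by
    refine pow_ne_zero _ fun h0 => ?_
    have := congrArg Subtype.val h0
    norm_num at this
  have hdiv : (3 : integralClosure ℤ ℂ) ∣ u * (m : integralClosure ℤ ℂ) := by
    rw [pow_succ, mul_left_comm] at h3a
    exact (mul_dvd_mul_iff_left h3ne).1 h3a
  have hmem : u * (m : integralClosure ℤ ℂ) ∈ 𝔐 := by
    obtain ⟨r, hr⟩ := hdiv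
    rw [hr]; exact 𝔐.mul_mem_right r h3
  rcases h𝔐.isPrime.mem_or_mem hmem with hu' | hm'
  · exact hu hu'
  · have hcop : IsCoprime (m : integralClosure ℤ ℂ) (3 : integralClosure ℤ ℂ) := by
      have hnat : Nat.Coprime m 3 :=
        Nat.coprime_comm.1 ((Nat.Prime.coprime_iff_not_dvd Nat.prime_three).2 hm3)
      have hz : IsCoprime (m : ℤ) (3 : ℤ) := Nat.isCoprime_iff_coprime.2 hnat
      simpa using hz.map (Int.castRingHom (integralClosure ℤ ℂ))
    obtain ⟨x, y, hxy⟩ := hcop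
    exact h𝔐.ne_top ((Ideal.eq_top_iff_one _).2
      (hxy ▸ 𝔐.add_mem (𝔐.mul_mem_left x hm') (𝔐.mul_mem_left y h3)))

/-! ### Normalisations: `C = L` for `GL₃`; an exact regular match gives the conclusion -/

/-- For `GL₃`, C-algebraic and L-algebraic infinity types coincide: the exponents of a
C-algebraic type lie in `(3-1)/2 + ℤ = ℤ`. [cite: BuzzardGee2014, Def. 3.1.1 and §5.3] -/
theorem isCAlgebraic_iff_isLAlgebraic_three {F : Type*} [Field F] (T : InfinityType F 3) :
    T.IsCAlgebraic ↔ T.IsLAlgebraic := by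
  have h1 : (((3 : ℕ) : ℂ) - 1) / 2 = 1 := by norm_num
  simp only [InfinityType.IsCAlgebraic, InfinityType.IsLAlgebraic, h1]
  refine forall_congr' fun σ => forall₂_congr fun p _ => ?_
  constructor
  · rintro ⟨k, l, hk, hl⟩
    exact ⟨k + 1, l + 1, by rw [hk]; push_cast; ring, by rw [hl]; push_cast; ring⟩
  · rintro ⟨k, l, hk, hl⟩
    exact ⟨k - 1, l - 1, by rw [hk]; push_cast; ring, by rw [hl]; push_cast; ring⟩

/-- Every regular algebraic `P` on `GL₃(𝔸_K)` is L-algebraic (`n = 3`).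
[cite: BuzzardGee2014, Def. 3.1.1 and §5.3] -/
theorem isLAlgebraic_of_isRegularAlgebraic {K : Type} [Field K] [NumberField K]
    {hcpt : isCompact_glFiniteIntegralLevel 3 K} (P : CuspidalAutomorphicRepData 3 K hcpt)
    (h : P.1.IsRegularAlgebraic) : P.1.IsLAlgebraic := by
  obtain ⟨T, hT, hC, -⟩ := h
  exact ⟨T, hT, (isCAlgebraic_iff_isLAlgebraic_three T).1 hC⟩

/-- **Normalisation coherence for `IrregularClassicality` / `PicardAutomorphy`.**  If ONE regular
algebraic cuspidal `P` on `GL₃(𝔸_{ℚ(ω)})` matches the Picard traces exactly off a finite `S`,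
`N𝔭 · Σα(P, 𝔭) = e(a_𝔭(f))`, then the common conclusion of crux and target holds for `f`:
`π := P ⊗ |det|_𝔸^{-1}` is cuspidal (`exists_twist_hasInfinityType`, Borel–Jacquet 5.7),
L-algebraic (integer twist of a C = L-algebraic type) and has Satake parameters `q_𝔭 · α`
(`HasSatakeParamAt.of_map_mulChar_detTwist_of_cpow`), so `Σ Satake(π, 𝔭) = N𝔭·Σα = e(a_𝔭(f))`.
(On paper the hypothesis is empty for generic `f` — regular versus `{0,0,1}` Hodge–Tate weights —
so this is a typing certificate, not a proof strategy.) [folklore] -/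
theorem automorphy_of_exact_regular_match {f : ℤ[X]}
    {hcpt : isCompact_glFiniteIntegralLevel 3 (CyclotomicField 3 ℚ)}
    (e : CyclotomicField 3 ℚ →+* ℂ)
    (S : Finset (HeightOneSpectrum (𝓞 (CyclotomicField 3 ℚ))))
    (P : CuspidalAutomorphicRepData 3 (CyclotomicField 3 ℚ) hcpt) (hreg : P.1.IsRegularAlgebraic)
    (hS : ∀ 𝔭 ∉ S, ∃ α : Multiset ℂ, P.1.HasSatakeParamAt 𝔭 α ∧
      (𝔭.residueCard : ℂ) * α.sum = e (picardTrace f 𝔭)) :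
    ∃ (e : CyclotomicField 3 ℚ →+* ℂ)
      (π : CuspidalAutomorphicRepData 3 (CyclotomicField 3 ℚ) hcpt), π.1.IsLAlgebraic ∧
      ∀ᶠ 𝔭 : HeightOneSpectrum (𝓞 (CyclotomicField 3 ℚ)) in cofinite, ∃ α : Multiset ℂ,
        π.1.HasSatakeParamAt 𝔭 α ∧ α.sum = e (picardTrace f 𝔭) := by
  obtain ⟨T, hT, hC, -⟩ := hreg
  obtain ⟨χ, π', hχ, hW, hW', hT'⟩ := P.exists_twist_hasInfinityType (-1 : ℝ) hT
  refine ⟨e, π', ⟨_, hT', ?_⟩, ?_⟩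
  · intro σ p hp
    rw [InfinityType.twist_apply, Multiset.mem_map] at hp
    obtain ⟨p₀, hp₀, rfl⟩ := hp
    obtain ⟨k, l, hk, hl⟩ := hC σ p₀ hp₀
    refine ⟨k, l, ?_, ?_⟩
    · rw [ArchWeight.twist_a, hk]; push_cast; ring
    · rw [ArchWeight.twist_b, hl]; push_cast; ring
  · refine (S.eventually_cofinite_notMem).mono fun 𝔭 h𝔭 => ?_
    obtain ⟨α, hα, heq⟩ := hS 𝔭 h𝔭
    refine ⟨_, AutomorphicRepData.HasSatakeParamAt.of_map_mulChar_detTwist_of_cpow hχ hW hW' hα, ?_⟩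
    rw [Multiset.sum_map_mul_left, Multiset.map_id', ← heq]
    congr 1
    push_cast
    simp

/-- **`IrregularClassicality` holds for stationary towers.**  If the crux's limit hypothesis is
witnessed by a `P` and, at each `𝔭 ∉ S`, a Satake parameter `α` and an algebraic integer
`t = N𝔭·Σα - e(a_𝔭(f))` that serve EVERY depth `k` (`∀ k, ∃ u ∉ 𝔐, u t ∈ (3^k)`), then the
conclusion holds for `f` — with no hypothesis on `f` at all: rigidity (`eq_zero_of_forall_congr`)
makes the match exact and `automorphy_of_exact_regular_match` applies.  The crux's difficulty is
therefore entirely in towers whose `P_k` genuinely vary with `k`. [folklore] -/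
theorem irregularClassicality_of_stationary {f : ℤ[X]}
    {hcpt : isCompact_glFiniteIntegralLevel 3 (CyclotomicField 3 ℚ)}
    (e : CyclotomicField 3 ℚ →+* ℂ) {𝔐 : Ideal (integralClosure ℤ ℂ)} (h𝔐 : 𝔐.IsMaximal)
    (h3 : (3 : integralClosure ℤ ℂ) ∈ 𝔐)
    (S : Finset (HeightOneSpectrum (𝓞 (CyclotomicField 3 ℚ))))
    (P : CuspidalAutomorphicRepData 3 (CyclotomicField 3 ℚ) hcpt) (hreg : P.1.IsRegularAlgebraic)
    (hS : ∀ 𝔭 ∉ S, ∃ (α : Multiset ℂ) (t : integralClosure ℤ ℂ), P.1.HasSatakeParamAt 𝔭 α ∧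
      (t : ℂ) = (𝔭.residueCard : ℂ) * α.sum - e (picardTrace f 𝔭) ∧
      ∀ k : ℕ, ∃ u ∉ 𝔐, u * t ∈ Ideal.span {(3 : integralClosure ℤ ℂ) ^ k}) :
    ∃ (e : CyclotomicField 3 ℚ →+* ℂ)
      (π : CuspidalAutomorphicRepData 3 (CyclotomicField 3 ℚ) hcpt), π.1.IsLAlgebraic ∧
      ∀ᶠ 𝔭 : HeightOneSpectrum (𝓞 (CyclotomicField 3 ℚ)) in cofinite, ∃ α : Multiset ℂ,
        π.1.HasSatakeParamAt 𝔭 α ∧ α.sum = e (picardTrace f 𝔭) := by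
  refine automorphy_of_exact_regular_match e S P hreg fun 𝔭 h𝔭 => ?_
  obtain ⟨α, t, hα, ht, hk⟩ := hS 𝔭 h𝔭
  have ht0 : t = 0 := eq_zero_of_forall_congr h𝔐 h3 hk
  subst ht0
  refine ⟨α, hα, sub_eq_zero.1 ?_⟩
  rw [← ht]; simp

end Summit.Langlands.Langlands.Theorems.IrregularClassicality.Negative
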